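import Literature.AlgebraicGeometry.ShimuraVarieties.UnitaryShimuraCurveRecord
import Literature.AlgebraicGeometry.ModuliOfAbelianVarieties.SiegelRationalStabiliserTrivial
import HarnessLib

/-!
# Injectivity of the Siegel point map DESCENDS to the saturated sublevels `K ⊓ b⁻¹K_δ(N)` ([Deligne 1971] Prop. 1.15, neat step)

Topic `AlgebraicGeometry/ShimuraVarieties`; namespace `Literature.AlgebraicGeometry.ShimuraVarieties.UnitaryCurve`.
THEOREMS ONLY (no `def`, no named fact, no instance, no `sorry`).  Cell `hodgecm-mathlib`, crux HLiu418 (stmt-HodgeConjecture-24832),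
sub-line P6a, E-line `F0_P6a_PELWitnessE`, organ «DELIGNE 1.15 AT PRINCIPAL LEVEL» (LEAD F0P6-plan (g3) «M-52» 2026-09-02T00:57Z), part
(B) «NEAT UPGRADE» — the sister of ★ FILE A `UnitaryCurveSiegelPointMap` (the class map `[v, aK] ↦ [J(v), b(a)·K_δ(N)]`) and ★ FILE B
`UnitaryCurveSiegelPointSeparation` (separation along the whole tower).  Here: the FINITE-LEVEL statement that turns Deligne's Noetherian
stationarity (which yields separation of `Sh_K` by ONE deep level `N`, but only through the ill-defined shadow at level `N > N₀`) into an
honest INJECTIVE point map at the saturated sublevel `K♮_N := K ⊓ b⁻¹K_δ(N)`.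

THE DATUM (hypotheses; cf. FILES A–B and the `AuxChartGS` fields of the E-line): `J : (Fin 2 → ℂ) → M_{2g}(ℝ)` valued in `S^±` on the
negative cone of `J⋆^τ` (`hJ`), constant on punctured lines (`hJsmul`); `b : U(J⋆)(𝔸_{L⁺,f}) → GSp_δ(𝔸_f)` with rational companion `bq`
(`hb`) and equivariance `hJrat` (`J(γ^τ v) = bq(γ) J(v) bq(γ)⁻¹`); a source level `K ≤ b⁻¹K_δ(N₀)` with `N₀ ≥ 3` and a deeper Siegel level
`N`, `N₀ ∣ N`.

WHAT IS PROVED ([Deligne1971TravauxShimura] Prop. 1.15 p. 132, the step «`Γ` sans torsion … `q = γ`»; [Milne2005ShimuraVarieties] Thm. 5.17,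
Lemma 5.13, Prop. 3.1, Prop. 3.5).
* `gs_mk_inf_comap_eq_of_gs_mk_eq_of_siegel_mk_eq` — **THE PAIR LAW**: if `[v, aK] = [v′, a′K]` in `Sh_K` AND `[J v, b a]_{K_δ(N)} =
  [J v′, b a′]_{K_δ(N)}`, then `[v, a] = [v′, a′]` already in `Sh_{K ⊓ b⁻¹K_δ(N)}` — i.e. `Sh_{K♮_N} → Sh_K × Sh_{K_δ(N)}(GSp_δ, S^±)` is
  injective.  Proof: the `Sh_K`-relation gives `γ ∈ U(L⁺)`, `c`, `κ := (γa′)⁻¹a ∈ K`; the Siegel relation gives `q ∈ GSp_δ(ℚ)`,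
  `k := (q·b a′)⁻¹ b a ∈ K_δ(N)`; `r := bq(γ)⁻¹ q` FIXES `J v′` (`hJrat`, `hJsmul`) and `(b a′)⁻¹ r_𝔸 (b a′) = b(κ) k⁻¹ ∈ K_δ(N₀)`, so `r = 1` by
  ★ `eq_one_of_conjAct_eq_of_conj_mem_principalLevelSubgroup` (the arithmetic group `GSp_δ(ℚ) ∩ xK_δ(N₀)x⁻¹` acts freely on `S^±`); hence
  `q = bq γ` and `b(κ) = k ∈ K_δ(N)`, `κ ∈ K ⊓ b⁻¹K_δ(N)`.
* `gs_mk_inf_comap_eq_of_siegel_mk_eq` — with SEPARATION OF `Sh_K` BY THE LEVEL-`N` SHADOW as hypothesis (`hsep`, quantified over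
  representatives — exactly the output of Deligne's stationarity on the fixed Noetherian `X_K`, ★ `Motives.exists_injective_map_of_iInter_eq_diagonal`
  with ★ FILE B `gs_mk_eq_of_forall_siegel_mk_eq`), level-`N` Siegel equality ALONE forces equality in `Sh_{K ⊓ b⁻¹K_δ(N)}`.
* `siegelPointMap_injective_of_sep` — map form: under `hsep`, ANY `ψ : Sh_{K ⊓ b⁻¹K_δ(N)}(ℂ) → Sh_{K_δ(N)}(GSp_δ, S^±)(ℂ)` with FILE A's
  formula (★ `exists_siegelPointMapGS` at the level `K ⊓ b⁻¹K_δ(N) ≤ b⁻¹K_δ(N)`) is INJECTIVE — the `sep` export of the E-line at the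
  `b`-saturated witness level (LEAD «M-52» (i)).

No polarisation-type, continuity, compactness or `hbrat` hypothesis is needed here (they enter only through stationarity∕FILE B).  HC_CM is
proved only modulo the 2 remaining named inputs (hLiu418 24832, h413 24833) until rung 0 closes; this file discharges neither (count-neutral
support of 24832).

## References
* [Deligne1971TravauxShimura] P. Deligne, *Travaux de Shimura*, Sém. Bourbaki 389 (1971), Prop. 1.15 with its proof and Lemme 1.15.3 p. 132, 1.8 p. 129.
* [Milne2005ShimuraVarieties] J. S. Milne, *Introduction to Shimura varieties* (2005; rev. 2017), Prop. 3.1 p. 32, Prop. 3.5 p. 34, Lemma 5.13 p. 57, Thm. 5.17 p. 59.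
* [Deligne1979ShimuraVarieties] P. Deligne, *Variétés de Shimura* (1979), Prop. 2.3.10, 2.1.2.
-/

set_option autoImplicit false

noncomputable section

open Function Matrix NumberField IsDedekindDomain
open scoped Matrix ComplexOrder
open Literature.NumberTheory.Automorphic.UnitaryGroup
open Literature.AlgebraicGeometry.ModuliOfAbelianVarieties

namespace Literature.AlgebraicGeometry.ShimuraVarieties

open UnitaryCanonicalModel

namespace UnitaryCurve

variable {L : Type} [Field L] [NumberField L] [IsCMField L] {Jstar : Matrix (Fin 2) (Fin 2) L} {τ : L →+* ℂ}
variable {g : ℕ} {δ : Fin g → ℕ}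
variable (J : (Fin 2 → ℂ) → Matrix (Fin g ⊕ Fin g) (Fin g ⊕ Fin g) ℝ)
  (hJ : ∀ v : Fin 2 → ℂ, v ∈ negCone (Jstar.map τ) → J v ∈ C0pm δ)
  (b : ↥(finAdelic (↥(maximalRealSubfield L)) L (IsCMField.complexConj L) 2 Jstar) →* ↥(gspFinAdelic δ))
  (bq : ↥(rational (↥(maximalRealSubfield L)) L (IsCMField.complexConj L) 2 Jstar) →* ↥(gspRational δ))

/-- **THE PAIR LAW ([Deligne 1971] Prop. 1.15, neat step): `Sh_{K ⊓ b⁻¹K_δ(N)}(U(J⋆), 𝔻)(ℂ) → Sh_K(ℂ) × Sh_{K_δ(N)}(GSp_δ, S^±)(ℂ)` is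
injective.**  Let `K ≤ b⁻¹K_δ(N₀)`, `N₀ ≥ 3`, `N₀ ∣ N`.  If `[v, aK] = [v′, a′K]` and `[J v, b a]_{K_δ(N)} = [J v′, b a′]_{K_δ(N)}`, then
`[v, a] = [v′, a′]` in `Sh_{K ⊓ b⁻¹K_δ(N)}`: with `γ, c, κ ∈ K` from the first relation and `q ∈ GSp_δ(ℚ)`, `k ∈ K_δ(N)` from the second,
the rational similitude `r = bq(γ)⁻¹ q` fixes `J v′` and satisfies `(b a′)⁻¹ r_𝔸 (b a′) = b(κ) k⁻¹ ∈ K_δ(N₀)`, hence `r = 1` (★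
`eq_one_of_conjAct_eq_of_conj_mem_principalLevelSubgroup`: `GSp_δ(ℚ) ∩ xK_δ(N₀)x⁻¹` acts freely on `S^±`), so `q = bq γ` and
`b(κ) = k ∈ K_δ(N)`. [cite: Deligne1971TravauxShimura, Prop. 1.15 (proof) and Lemme 1.15.3 p. 132] [cite: Milne2005ShimuraVarieties, Thm. 5.17 p. 59, Lemma 5.13 p. 57, Prop. 3.1 p. 32] -/
theorem gs_mk_inf_comap_eq_of_gs_mk_eq_of_siegel_mk_eq
    (hJsmul : ∀ c : ℂ, c ≠ 0 → ∀ v : Fin 2 → ℂ, v ∈ negCone (Jstar.map τ) → J (c • v) = J v)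
    (hb : ∀ γ : ↥(rational (↥(maximalRealSubfield L)) L (IsCMField.complexConj L) 2 Jstar),
      b (rationalToFinAdelic (↥(maximalRealSubfield L)) L (IsCMField.complexConj L) 2 Jstar γ) = gspRationalToFinAdelic δ (bq γ))
    (hJrat : ∀ (γ : ↥(rational (↥(maximalRealSubfield L)) L (IsCMField.complexConj L) 2 Jstar)) (v : Fin 2 → ℂ),
      v ∈ negCone (Jstar.map τ) →
        J (((ratToGLℂ L Jstar τ γ : GL (Fin 2) ℂ) : Matrix (Fin 2) (Fin 2) ℂ) *ᵥ v) =
          conjJ ((gspRationalToReal δ (bq γ) : ↥(gspReal δ)) : GL (Fin g ⊕ Fin g) ℝ) (J v))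
    {N₀ N : ℕ} (hN₀ : 3 ≤ N₀) (hdvd : N₀ ∣ N)
    (K : Subgroup ↥(finAdelic (↥(maximalRealSubfield L)) L (IsCMField.complexConj L) 2 Jstar))
    (hle : K ≤ (principalLevelSubgroup δ N₀).comap b)
    {v v' : Fin 2 → ℂ} (hv : v ∈ negCone (Jstar.map τ)) (hv' : v' ∈ negCone (Jstar.map τ))
    {a a' : ↥(finAdelic (↥(maximalRealSubfield L)) L (IsCMField.complexConj L) 2 Jstar)}
    (hK : ShimuraSetGS.mk L Jstar τ K v hv a = ShimuraSetGS.mk L Jstar τ K v' hv' a')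
    (hN : SiegelShimuraSet.mk δ (principalLevelSubgroup δ N) ⟨J v, hJ v hv⟩ (b a) =
      SiegelShimuraSet.mk δ (principalLevelSubgroup δ N) ⟨J v', hJ v' hv'⟩ (b a')) :
    ShimuraSetGS.mk L Jstar τ (K ⊓ (principalLevelSubgroup δ N).comap b) v hv a =
      ShimuraSetGS.mk L Jstar τ (K ⊓ (principalLevelSubgroup δ N).comap b) v' hv' a' := by
  -- the unitary relation at level `K`: `c • γ^τ v' = v`, `κ := (γ_𝔸 a')⁻¹ a ∈ K`
  obtain ⟨γ, c, hc, hcv, hk⟩ := (ShimuraSetGS.mk_eq_mk_iff L Jstar τ K v v' hv hv' a a').1 hK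
  have hκK : (rationalToFinAdelic (↥(maximalRealSubfield L)) L (IsCMField.complexConj L) 2 Jstar γ * a')⁻¹ * a ∈ K := by
    rw [MulAction.Quotient.smul_mk, smul_eq_mul, QuotientGroup.eq] at hk
    exact hk
  -- the Siegel relation at level `K_δ(N)`: `q J v' q⁻¹ = J v`, `k := (q_𝔸 · b a')⁻¹ b a ∈ K_δ(N)`
  obtain ⟨q, hqJ, hq⟩ := (SiegelShimuraSet.mk_eq_mk_iff δ (principalLevelSubgroup δ N) _ _ _ _).1 hN
  have hkN : (gspRationalToFinAdelic δ q * b a')⁻¹ * b a ∈ principalLevelSubgroup δ N := by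
    rw [MulAction.Quotient.smul_mk, smul_eq_mul, QuotientGroup.eq] at hq
    exact hq
  -- `bq γ` moves `J v'` to `J v` as well
  have hγv' : ((ratToGLℂ L Jstar τ γ : GL (Fin 2) ℂ) : Matrix (Fin 2) (Fin 2) ℂ) *ᵥ v' = c⁻¹ • v := by
    rw [← hcv, smul_smul, inv_mul_cancel₀ hc, one_smul]
  have hγJ : conjAct δ (gspRationalToReal δ (bq γ)) ⟨J v', hJ v' hv'⟩ = ⟨J v, hJ v hv⟩ := by
    apply Subtype.ext
    rw [coe_conjAct]
    change conjJ _ (J v') = J v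
    rw [← hJrat γ v' hv', hγv', hJsmul c⁻¹ (inv_ne_zero hc) v hv]
  -- the rational stabiliser `r := (bq γ)⁻¹ q` of `J v'`
  have hrJ : conjAct δ (gspRationalToReal δ ((bq γ)⁻¹ * q)) ⟨J v', hJ v' hv'⟩ = ⟨J v', hJ v' hv'⟩ := by
    rw [map_mul, conjAct_mul, hqJ, ← hγJ, ← conjAct_mul, ← map_mul, inv_mul_cancel, map_one, conjAct_one]
  -- `(b a')⁻¹ r_𝔸 (b a') = b(κ) · k⁻¹ ∈ K_δ(N₀)`
  have hrx : (b a')⁻¹ * (gspRationalToFinAdelic δ ((bq γ)⁻¹ * q) * b a') ∈ principalLevelSubgroup δ N₀ := by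
    have e : (b a')⁻¹ * (gspRationalToFinAdelic δ ((bq γ)⁻¹ * q) * b a') =
        b ((rationalToFinAdelic (↥(maximalRealSubfield L)) L (IsCMField.complexConj L) 2 Jstar γ * a')⁻¹ * a) *
          ((gspRationalToFinAdelic δ q * b a')⁻¹ * b a)⁻¹ := by
      simp only [map_mul, map_inv, hb]
      group
    rw [e]
    exact mul_mem (hle hκK) (inv_mem (principalLevelSubgroup_anti δ hdvd hkN))
  -- Deligne: `r = 1`, i.e. `q = bq γ`
  have hr1 : (bq γ)⁻¹ * q = 1 := eq_one_of_conjAct_eq_of_conj_mem_principalLevelSubgroup hN₀ hrJ hrx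
  have hqγ : q = bq γ := (inv_mul_eq_one.1 hr1).symm
  -- hence `b(κ) = k ∈ K_δ(N)`
  have hbκ : b ((rationalToFinAdelic (↥(maximalRealSubfield L)) L (IsCMField.complexConj L) 2 Jstar γ * a')⁻¹ * a) ∈
      principalLevelSubgroup δ N := by
    rw [map_mul, map_inv, map_mul, hb, ← hqγ]
    exact hkN
  -- the classes agree at the level `K ⊓ b⁻¹K_δ(N)`
  refine (ShimuraSetGS.mk_eq_mk_iff L Jstar τ _ v v' hv hv' a a').2 ⟨γ, c, hc, hcv, ?_⟩
  rw [MulAction.Quotient.smul_mk, smul_eq_mul, QuotientGroup.eq]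
  exact Subgroup.mem_inf.2 ⟨hκK, hbκ⟩

/-- **SEPARATION OF `Sh_K` BY THE LEVEL-`N` SHADOW ⇒ INJECTIVITY AT THE SATURATED SUBLEVEL** ([Deligne 1971] Prop. 1.15 at principal level).
Let `K ≤ b⁻¹K_δ(N₀)`, `N₀ ≥ 3`, `N₀ ∣ N`, and suppose (`hsep`, the output of Deligne's Noetherian stationarity on `X_K`, ★
`Motives.exists_injective_map_of_iInter_eq_diagonal` with ★ `gs_mk_eq_of_forall_siegel_mk_eq`) that `[J v, b a]_{K_δ(N)} = [J v′, b a′]_{K_δ(N)}`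
forces `[v, aK] = [v′, a′K]` for ALL representatives.  Then it forces `[v, a] = [v′, a′]` in `Sh_{K ⊓ b⁻¹K_δ(N)}`.
[cite: Deligne1971TravauxShimura, Prop. 1.15 (proof) p. 132] [cite: Milne2005ShimuraVarieties, Thm. 5.17 p. 59 and Lemma 5.13 p. 57] -/
theorem gs_mk_inf_comap_eq_of_siegel_mk_eq
    (hJsmul : ∀ c : ℂ, c ≠ 0 → ∀ v : Fin 2 → ℂ, v ∈ negCone (Jstar.map τ) → J (c • v) = J v)
    (hb : ∀ γ : ↥(rational (↥(maximalRealSubfield L)) L (IsCMField.complexConj L) 2 Jstar),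
      b (rationalToFinAdelic (↥(maximalRealSubfield L)) L (IsCMField.complexConj L) 2 Jstar γ) = gspRationalToFinAdelic δ (bq γ))
    (hJrat : ∀ (γ : ↥(rational (↥(maximalRealSubfield L)) L (IsCMField.complexConj L) 2 Jstar)) (v : Fin 2 → ℂ),
      v ∈ negCone (Jstar.map τ) →
        J (((ratToGLℂ L Jstar τ γ : GL (Fin 2) ℂ) : Matrix (Fin 2) (Fin 2) ℂ) *ᵥ v) =
          conjJ ((gspRationalToReal δ (bq γ) : ↥(gspReal δ)) : GL (Fin g ⊕ Fin g) ℝ) (J v))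
    {N₀ N : ℕ} (hN₀ : 3 ≤ N₀) (hdvd : N₀ ∣ N)
    (K : Subgroup ↥(finAdelic (↥(maximalRealSubfield L)) L (IsCMField.complexConj L) 2 Jstar))
    (hle : K ≤ (principalLevelSubgroup δ N₀).comap b)
    (hsep : ∀ (v v' : Fin 2 → ℂ) (hv : v ∈ negCone (Jstar.map τ)) (hv' : v' ∈ negCone (Jstar.map τ))
      (a a' : ↥(finAdelic (↥(maximalRealSubfield L)) L (IsCMField.complexConj L) 2 Jstar)),
      SiegelShimuraSet.mk δ (principalLevelSubgroup δ N) ⟨J v, hJ v hv⟩ (b a) =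
          SiegelShimuraSet.mk δ (principalLevelSubgroup δ N) ⟨J v', hJ v' hv'⟩ (b a') →
        ShimuraSetGS.mk L Jstar τ K v hv a = ShimuraSetGS.mk L Jstar τ K v' hv' a')
    {v v' : Fin 2 → ℂ} (hv : v ∈ negCone (Jstar.map τ)) (hv' : v' ∈ negCone (Jstar.map τ))
    {a a' : ↥(finAdelic (↥(maximalRealSubfield L)) L (IsCMField.complexConj L) 2 Jstar)}
    (hN : SiegelShimuraSet.mk δ (principalLevelSubgroup δ N) ⟨J v, hJ v hv⟩ (b a) =
      SiegelShimuraSet.mk δ (principalLevelSubgroup δ N) ⟨J v', hJ v' hv'⟩ (b a')) :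
    ShimuraSetGS.mk L Jstar τ (K ⊓ (principalLevelSubgroup δ N).comap b) v hv a =
      ShimuraSetGS.mk L Jstar τ (K ⊓ (principalLevelSubgroup δ N).comap b) v' hv' a' :=
  gs_mk_inf_comap_eq_of_gs_mk_eq_of_siegel_mk_eq J hJ b bq hJsmul hb hJrat hN₀ hdvd K hle hv hv'
    (hsep v v' hv hv' a a' hN) hN

/-- **THE LEVEL-`N` POINT MAP IS INJECTIVE ON `Sh_{K ⊓ b⁻¹K_δ(N)}(ℂ)`** (map form; the `sep` export of the E-line at the `b`-saturated witness
level): under `hsep` (separation of `Sh_K` by the level-`N` shadow), every `ψ : Sh_{K ⊓ b⁻¹K_δ(N)}(U(J⋆), 𝔻)(ℂ) → Sh_{K_δ(N)}(GSp_δ, S^±)(ℂ)` acting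
by FILE A's formula `ψ [v, a] = [J(v), b(a)·K_δ(N)]` (★ `exists_siegelPointMapGS`, the level `K ⊓ b⁻¹K_δ(N)` lying below `b⁻¹K_δ(N)`) is injective.
[cite: Deligne1971TravauxShimura, Prop. 1.15 p. 132] [cite: Milne2005ShimuraVarieties, Thm. 5.17 p. 59] [cite: Deligne1979ShimuraVarieties, Prop. 2.3.10] -/
theorem siegelPointMap_injective_of_sep
    (hJsmul : ∀ c : ℂ, c ≠ 0 → ∀ v : Fin 2 → ℂ, v ∈ negCone (Jstar.map τ) → J (c • v) = J v)
    (hb : ∀ γ : ↥(rational (↥(maximalRealSubfield L)) L (IsCMField.complexConj L) 2 Jstar),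
      b (rationalToFinAdelic (↥(maximalRealSubfield L)) L (IsCMField.complexConj L) 2 Jstar γ) = gspRationalToFinAdelic δ (bq γ))
    (hJrat : ∀ (γ : ↥(rational (↥(maximalRealSubfield L)) L (IsCMField.complexConj L) 2 Jstar)) (v : Fin 2 → ℂ),
      v ∈ negCone (Jstar.map τ) →
        J (((ratToGLℂ L Jstar τ γ : GL (Fin 2) ℂ) : Matrix (Fin 2) (Fin 2) ℂ) *ᵥ v) =
          conjJ ((gspRationalToReal δ (bq γ) : ↥(gspReal δ)) : GL (Fin g ⊕ Fin g) ℝ) (J v))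
    {N₀ N : ℕ} (hN₀ : 3 ≤ N₀) (hdvd : N₀ ∣ N)
    (K : Subgroup ↥(finAdelic (↥(maximalRealSubfield L)) L (IsCMField.complexConj L) 2 Jstar))
    (hle : K ≤ (principalLevelSubgroup δ N₀).comap b)
    (hsep : ∀ (v v' : Fin 2 → ℂ) (hv : v ∈ negCone (Jstar.map τ)) (hv' : v' ∈ negCone (Jstar.map τ))
      (a a' : ↥(finAdelic (↥(maximalRealSubfield L)) L (IsCMField.complexConj L) 2 Jstar)),
      SiegelShimuraSet.mk δ (principalLevelSubgroup δ N) ⟨J v, hJ v hv⟩ (b a) =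
          SiegelShimuraSet.mk δ (principalLevelSubgroup δ N) ⟨J v', hJ v' hv'⟩ (b a') →
        ShimuraSetGS.mk L Jstar τ K v hv a = ShimuraSetGS.mk L Jstar τ K v' hv' a')
    (ψ : ShimuraSetGS L Jstar τ (K ⊓ (principalLevelSubgroup δ N).comap b) → SiegelShimuraSet δ (principalLevelSubgroup δ N))
    (hψ : ∀ (v : Fin 2 → ℂ) (hv : v ∈ negCone (Jstar.map τ))
      (a : ↥(finAdelic (↥(maximalRealSubfield L)) L (IsCMField.complexConj L) 2 Jstar)),
      ψ (ShimuraSetGS.mk L Jstar τ (K ⊓ (principalLevelSubgroup δ N).comap b) v hv a) =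
        SiegelShimuraSet.mk δ (principalLevelSubgroup δ N) ⟨J v, hJ v hv⟩ (b a)) :
    Function.Injective ψ := by
  intro x y hxy
  obtain ⟨v, hv, a, rfl⟩ := ShimuraSetGS.mk_surjective L Jstar τ _ x
  obtain ⟨v', hv', a', rfl⟩ := ShimuraSetGS.mk_surjective L Jstar τ _ y
  rw [hψ, hψ] at hxy
  exact gs_mk_inf_comap_eq_of_siegel_mk_eq J hJ b bq hJsmul hb hJrat hN₀ hdvd K hle hsep hv hv' hxy

/-- **At the `b`-SATURATED level `K♮ = b⁻¹K_δ(N) ≤ K`** (the shape of LEAD «M-52» (i), `K♮_N := b⁻¹K_δ(N)`): if `b⁻¹K_δ(N) ≤ K` then, under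
`hsep`, every level-`N` point map `ψ` on `Sh_{b⁻¹K_δ(N)}(ℂ)` with FILE A's formula is injective (`K ⊓ b⁻¹K_δ(N) = b⁻¹K_δ(N)`).
[cite: Deligne1971TravauxShimura, Prop. 1.15 p. 132] [cite: Milne2005ShimuraVarieties, Thm. 5.17 p. 59] -/
theorem siegelPointMap_injective_comap_of_sep
    (hJsmul : ∀ c : ℂ, c ≠ 0 → ∀ v : Fin 2 → ℂ, v ∈ negCone (Jstar.map τ) → J (c • v) = J v)
    (hb : ∀ γ : ↥(rational (↥(maximalRealSubfield L)) L (IsCMField.complexConj L) 2 Jstar),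
      b (rationalToFinAdelic (↥(maximalRealSubfield L)) L (IsCMField.complexConj L) 2 Jstar γ) = gspRationalToFinAdelic δ (bq γ))
    (hJrat : ∀ (γ : ↥(rational (↥(maximalRealSubfield L)) L (IsCMField.complexConj L) 2 Jstar)) (v : Fin 2 → ℂ),
      v ∈ negCone (Jstar.map τ) →
        J (((ratToGLℂ L Jstar τ γ : GL (Fin 2) ℂ) : Matrix (Fin 2) (Fin 2) ℂ) *ᵥ v) =
          conjJ ((gspRationalToReal δ (bq γ) : ↥(gspReal δ)) : GL (Fin g ⊕ Fin g) ℝ) (J v))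
    {N₀ N : ℕ} (hN₀ : 3 ≤ N₀) (hdvd : N₀ ∣ N)
    (K : Subgroup ↥(finAdelic (↥(maximalRealSubfield L)) L (IsCMField.complexConj L) 2 Jstar))
    (hle : K ≤ (principalLevelSubgroup δ N₀).comap b) (hsat : (principalLevelSubgroup δ N).comap b ≤ K)
    (hsep : ∀ (v v' : Fin 2 → ℂ) (hv : v ∈ negCone (Jstar.map τ)) (hv' : v' ∈ negCone (Jstar.map τ))
      (a a' : ↥(finAdelic (↥(maximalRealSubfield L)) L (IsCMField.complexConj L) 2 Jstar)),
      SiegelShimuraSet.mk δ (principalLevelSubgroup δ N) ⟨J v, hJ v hv⟩ (b a) =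
          SiegelShimuraSet.mk δ (principalLevelSubgroup δ N) ⟨J v', hJ v' hv'⟩ (b a') →
        ShimuraSetGS.mk L Jstar τ K v hv a = ShimuraSetGS.mk L Jstar τ K v' hv' a')
    (ψ : ShimuraSetGS L Jstar τ ((principalLevelSubgroup δ N).comap b) → SiegelShimuraSet δ (principalLevelSubgroup δ N))
    (hψ : ∀ (v : Fin 2 → ℂ) (hv : v ∈ negCone (Jstar.map τ))
      (a : ↥(finAdelic (↥(maximalRealSubfield L)) L (IsCMField.complexConj L) 2 Jstar)),
      ψ (ShimuraSetGS.mk L Jstar τ ((principalLevelSubgroup δ N).comap b) v hv a) =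
        SiegelShimuraSet.mk δ (principalLevelSubgroup δ N) ⟨J v, hJ v hv⟩ (b a)) :
    Function.Injective ψ := by
  intro x y hxy
  obtain ⟨v, hv, a, rfl⟩ := ShimuraSetGS.mk_surjective L Jstar τ _ x
  obtain ⟨v', hv', a', rfl⟩ := ShimuraSetGS.mk_surjective L Jstar τ _ y
  rw [hψ, hψ] at hxy
  have h := gs_mk_inf_comap_eq_of_siegel_mk_eq J hJ b bq hJsmul hb hJrat hN₀ hdvd K hle hsep hv hv' hxy
  have hK : K ⊓ (principalLevelSubgroup δ N).comap b = (principalLevelSubgroup δ N).comap b := inf_eq_right.2 hsat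
  rw [hK] at h
  exact h

end UnitaryCurve

end Literature.AlgebraicGeometry.ShimuraVarieties

end
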